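import Summits.ValiantsHypothesis.ValiantsHypothesis.Theorems.PolyaContinuedMonotoneCoverHardOneLevel

/-!
# Crux `MonotoneCoverHard` (stmt-ValiantsHypothesis-7421), width line — the ONE-LEVEL ENGINE in
level-free form: an **idle split** of a Pfaffian cover forces `n ≤ 2`

(val-width-7421-p4 g0, 2026-08-28; lane «width ≥ 3 at one level ⇒ non-Pfaffian».)  This file
extracts the mechanism of val-width-7421-p3's `no_oneLevel_pfaffian_cover` (`…OneLevel.lean`) from
its level function.  Setting: a cover `(m, E, a)` of `per_n` (labels in `{X j, 0, 1}`,
`per_n = aeval a PM_E`) with `E` Pfaffian in the route's symbolic sense, a weight-nonzero perfect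
matching `τ₀`, and two predicates `U`, `P` on the rows such that (an "idle split" of the rows
relative to `τ₀`; "used" = edge of some weight-nonzero perfect matching):

* the rows outside `U ∪ P` are exactly the rows whose `τ₀`-edge carries a variable (`hA`, `hU0`,
  `hP0`);
* rows of `U` emit no used variable edge at all (`hUrow`);
* no used variable edge runs from a row outside `U` into a `τ₀`-column of a `P`-row (`hPcol`);
* no used edge at all runs from a `U`-row into a `τ₀`-column of a row of `P ∖ U` (`hUP`).

Then (`no_pfaffian_cover_of_idleSplit`) `n ≤ 2`.  Proof = the two constant-pivot Schur steps of
`…OneLevel.lean` verbatim, with `Z ↦ U` and `B₀ ↦ P`: Pólya signing, `det M = per_n`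
(`det_signedLabel_eq_perPoly`), unimodular idle blocks `U × U` and `P × P`
(`det_idleBlock_eq_prod`), `det_eq_C_mul_det_schur` twice, `per_n = c · det L` with `L` affine of
size `#{variable τ₀-rows} = n` (`card_var_eq`), Mignon–Ressayre (`sq_le_two_mul_of_hasDetRepr_perPoly`).

Why level-free: the one-level theorem is the split `U = rows off level ℓ₀`, `P = idle rows of level
ℓ₀`; but the engine is also fed covers obtained by SUBSTITUTION (`…PureFiber.lean`: keep a block of
variables, set a partial permutation to `1`, the rest to `0`), which keep the Pfaffian edge set and the
label shape but NOT the level function (former variable edges set to `1` jump a level).  There the split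
is `U = rows above the level`, `P = rows below it ∪ idle rows at it`.  VP ≠ VNP is not moved;
`MonotoneCoverHard` stays open.  No definitions.
-/

namespace Summit.ValiantsHypothesis.ValiantsHypothesis.Theorems.PolyaContinuedMonotoneCoverHard

-- summit = sub-problem name (single-conjunct summit, D-0017 layout), so the namespace repeats it
set_option linter.dupNamespace false

open scoped Classical
open Finset
open Literature.Combinatorics.SimpleGraph (IsPolyaSigning)
open Literature.Computability.AlgebraicComplexity (HasDetRepr sq_le_two_mul_of_hasDetRepr_perPoly)
open Summit.ValiantsHypothesis.ValiantsHypothesis.Theorems.PolyaContinued.MonotoneCoverHardRectangle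
  (exists_labels aeval_permanent_cover perPoly_eq_sum_monomial label_bijection pexp_injective)

/-- **Idle-split engine.**  A cover `(m, E, a)` of `per_n` with Pfaffian `E` (route's symbolic form),
a weight-nonzero perfect matching `τ₀` and row predicates `U`, `P` forming an idle split relative to
`τ₀` (see the module docstring: rows outside `U ∪ P` are the variable `τ₀`-rows; `U`-rows emit no used
variable edge; no used variable edge from outside `U` into the `τ₀`-columns of `P`; no used edge from
`U` into the `τ₀`-columns of `P ∖ U`) can only exist for `n ≤ 2`. -/
theorem no_pfaffian_cover_of_idleSplit (n m : ℕ) (hn : 3 ≤ n) (E : Finset (Fin m × Fin m))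
    (a : Fin m × Fin m → MvPolynomial (Fin n × Fin n) ℂ)
    (hsig : ∃ s : Fin m × Fin m → ℂ, (∀ e, s e = 1 ∨ s e = -1) ∧
      (Matrix.of fun i j => if (i, j) ∈ E then MvPolynomial.C (s (i, j)) * MvPolynomial.X (i, j)
          else 0 : Matrix (Fin m) (Fin m) (MvPolynomial (Fin m × Fin m) ℂ)).det =
        (Matrix.of fun i j => if (i, j) ∈ E then MvPolynomial.X (i, j) else 0 :
          Matrix (Fin m) (Fin m) (MvPolynomial (Fin m × Fin m) ℂ)).permanent)
    (ha : ∀ e, (∃ j, a e = MvPolynomial.X j) ∨ a e = 0 ∨ a e = 1)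
    (hper : Literature.Computability.AlgebraicComplexity.perPoly (Fin n) ℂ =
      MvPolynomial.aeval a (Matrix.of fun i j => if (i, j) ∈ E then MvPolynomial.X (i, j) else 0 :
          Matrix (Fin m) (Fin m) (MvPolynomial (Fin m × Fin m) ℂ)).permanent)
    (τ₀ : Equiv.Perm (Fin m)) (hτ₀ : ∀ i, (i, τ₀ i) ∈ E ∧ a (i, τ₀ i) ≠ 0)
    (U P : Fin m → Prop)
    (hA : ∀ i, ¬ U i → ¬ P i → ∃ k, a (i, τ₀ i) = MvPolynomial.X k)
    (hU0 : ∀ i, U i → ¬ ∃ k, a (i, τ₀ i) = MvPolynomial.X k)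
    (hP0 : ∀ i, P i → ¬ ∃ k, a (i, τ₀ i) = MvPolynomial.X k)
    (hUrow : ∀ i j, U i →
      (∃ τ : Equiv.Perm (Fin m), (∀ k, (k, τ k) ∈ E ∧ a (k, τ k) ≠ 0) ∧ τ i = j) →
      ¬ ∃ k, a (i, j) = MvPolynomial.X k)
    (hPcol : ∀ i i', ¬ U i → P i' →
      (∃ τ : Equiv.Perm (Fin m), (∀ k, (k, τ k) ∈ E ∧ a (k, τ k) ≠ 0) ∧ τ i = τ₀ i') →
      ¬ ∃ k, a (i, τ₀ i') = MvPolynomial.X k)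
    (hUP : ∀ i i', U i → P i' → ¬ U i' →
      ¬ ∃ τ : Equiv.Perm (Fin m), (∀ k, (k, τ k) ∈ E ∧ a (k, τ k) ≠ 0) ∧ τ i = τ₀ i') :
    False := by
  obtain ⟨n, rfl⟩ : ∃ k, n = k + 3 := ⟨n - 3, by omega⟩
  clear hn
  -- Pólya signing, signed label matrix, `det M = per`
  obtain ⟨s, hs⟩ := exists_polyaSigning_of_symbolic E hsig
  obtain ⟨M, hM⟩ : ∃ M : Matrix (Fin m) (Fin m) (MvPolynomial (Fin (n + 3) × Fin (n + 3)) ℂ),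
      ∀ i j, M i j = if ∃ τ : Equiv.Perm (Fin m), (∀ k, (k, τ k) ∈ E ∧ a (k, τ k) ≠ 0) ∧ τ i = j
        then MvPolynomial.C ((s (i, j) : ℤ) : ℂ) * a (i, j) else 0 :=
    ⟨fun i j => if ∃ τ : Equiv.Perm (Fin m), (∀ k, (k, τ k) ∈ E ∧ a (k, τ k) ≠ 0) ∧ τ i = j
        then MvPolynomial.C ((s (i, j) : ℤ) : ℂ) * a (i, j) else 0, fun _ _ => rfl⟩
  have hdetM := det_signedLabel_eq_perPoly E a hper s hs M hM
  -- used edges carry nonzero labels; non-variable nonzero labels are `1`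
  have hK1 : ∀ i j, (∃ τ : Equiv.Perm (Fin m), (∀ k, (k, τ k) ∈ E ∧ a (k, τ k) ≠ 0) ∧ τ i = j) →
      (i, j) ∈ E ∧ a (i, j) ≠ 0 := by
    rintro i j ⟨τ, hτ, rfl⟩
    exact hτ i
  have hK2 : ∀ e, a e ≠ 0 → (¬ ∃ k, a e = MvPolynomial.X k) → a e = 1 := by
    intro e h1 h2
    rcases ha e with h | h | h
    · exact absurd h h2
    · exact absurd h h1
    · exact h
  have hunit : ∀ e, ((s e : ℤ) : ℂ) ≠ 0 := fun e => by
    rcases Int.units_eq_one_or (s e) with h | h <;> simp [h]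
  -- the column-permuted matrix `M₁ = M ∘ τ₀` and its constant companion `Sf`
  set M₁ : Matrix (Fin m) (Fin m) (MvPolynomial (Fin (n + 3) × Fin (n + 3)) ℂ) :=
    M.submatrix id τ₀ with hM₁def
  have hM₁ : ∀ i i', M₁ i i' =
      if ∃ τ : Equiv.Perm (Fin m), (∀ k, (k, τ k) ∈ E ∧ a (k, τ k) ≠ 0) ∧ τ i = τ₀ i'
      then MvPolynomial.C ((s (i, τ₀ i') : ℤ) : ℂ) * a (i, τ₀ i') else 0 := fun i i' => by
    rw [hM₁def, Matrix.submatrix_apply]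
    exact hM i (τ₀ i')
  have hdet₁ : M₁.det = ((Equiv.Perm.sign τ₀ : ℤ) : MvPolynomial (Fin (n + 3) × Fin (n + 3)) ℂ) *
      M.det := Matrix.det_permute' τ₀ M
  obtain ⟨Sf, hSf⟩ : ∃ Sf : Matrix (Fin m) (Fin m) ℂ, ∀ i i', Sf i i' =
      if ∃ τ : Equiv.Perm (Fin m), (∀ k, (k, τ k) ∈ E ∧ a (k, τ k) ≠ 0) ∧ τ i = τ₀ i'
      then ((s (i, τ₀ i') : ℤ) : ℂ) else 0 :=
    ⟨fun i i' => if ∃ τ : Equiv.Perm (Fin m), (∀ k, (k, τ k) ∈ E ∧ a (k, τ k) ≠ 0) ∧ τ i = τ₀ i'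
      then ((s (i, τ₀ i') : ℤ) : ℂ) else 0, fun _ _ => rfl⟩
  -- entries that cannot be variable are constant
  have hconst : ∀ i i',
      ((∃ τ : Equiv.Perm (Fin m), (∀ k, (k, τ k) ∈ E ∧ a (k, τ k) ≠ 0) ∧ τ i = τ₀ i') →
        ¬ ∃ k, a (i, τ₀ i') = MvPolynomial.X k) →
      M₁ i i' = MvPolynomial.C (Sf i i') := by
    intro i i' h
    rw [hM₁, hSf]
    split_ifs with hu
    · rw [hK2 _ (hK1 _ _ hu).2 (h hu), mul_one]
    · exact MvPolynomial.C_0.symm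
  -- all entries are affine-linear
  have hdeg : ∀ i i', (M₁ i i').totalDegree ≤ 1 := by
    intro i i'
    rw [hM₁]
    split_ifs with hu
    · by_cases hv : ∃ k, a (i, τ₀ i') = MvPolynomial.X k
      · obtain ⟨k, hk⟩ := hv
        rw [hk]
        calc (MvPolynomial.C ((s (i, τ₀ i') : ℤ) : ℂ) * MvPolynomial.X k).totalDegree
            ≤ (MvPolynomial.C ((s (i, τ₀ i') : ℤ) : ℂ) :
                MvPolynomial (Fin (n + 3) × Fin (n + 3)) ℂ).totalDegree +
              (MvPolynomial.X k : MvPolynomial (Fin (n + 3) × Fin (n + 3)) ℂ).totalDegree :=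
              MvPolynomial.totalDegree_mul _ _
          _ ≤ 0 + 1 := Nat.add_le_add (le_of_eq (MvPolynomial.totalDegree_C _))
              (MvPolynomial.totalDegree_X k).le
          _ = 1 := rfl
      · rw [hK2 _ (hK1 _ _ hu).2 hv, mul_one, MvPolynomial.totalDegree_C]
        exact Nat.zero_le _
    · rw [MvPolynomial.totalDegree_zero]
      exact Nat.zero_le _
  -- `U`-rows emit only constant entries
  have hZrow : ∀ i i', U i → M₁ i i' = MvPolynomial.C (Sf i i') :=
    fun i i' hi => hconst i i' fun hu hv => hUrow i (τ₀ i') hi hu hv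
  -- `U`-rows have no used edge into the `τ₀`-columns of `P ∖ U`
  have hZB0 : ∀ i j, U i → P j → ¬ U j → M₁ i j = 0 := by
    intro i j hi hj hj'
    rw [hM₁, if_neg (hUP i j hi hj hj')]
  -- rows outside `U` into the `τ₀`-columns of `P`: constant entries
  have hAB0 : ∀ i j, ¬ U i → P j → M₁ i j = MvPolynomial.C (Sf i j) :=
    fun i j hi hj => hconst i j fun hu hv => hPcol i j hi hj hu hv
  /- STEP 1: Schur complement through the idle block `U × U`. -/
  obtain ⟨p₁, hp₁⟩ : ∃ p₁ : Fin m → Prop, ∀ i, p₁ i ↔ U i := ⟨_, fun _ => Iff.rfl⟩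
  set S₁ : Matrix {i // p₁ i} {i // p₁ i} ℂ := Matrix.of fun i i' => Sf i i' with hS₁
  have hS₁det : S₁.det = ∏ i : {i // p₁ i}, ((s ((i : Fin m), τ₀ i) : ℤ) : ℂ) :=
    det_idleBlock_eq_prod E a ha hper s τ₀ hτ₀ p₁ (fun i hi => hU0 i ((hp₁ i).1 hi))
      (fun i i' hi _ hu hv => hUrow i (τ₀ i') ((hp₁ i).1 hi) hu hv) S₁
      (fun i i' => by rw [hS₁, Matrix.of_apply, hSf])
  have hS₁ne : S₁.det ≠ 0 := by
    rw [hS₁det]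
    exact Finset.prod_ne_zero_iff.2 fun i _ => hunit _
  have hstep1 := det_eq_C_mul_det_schur M₁ p₁ S₁ hS₁ne
    (fun i j => by rw [hS₁, Matrix.of_apply]; exact hZrow i j ((hp₁ _).1 i.2))
  set N' : Matrix {i // ¬ p₁ i} {i // ¬ p₁ i} (MvPolynomial (Fin (n + 3) × Fin (n + 3)) ℂ) :=
    Matrix.of fun (i j : {i // ¬ p₁ i}) => M₁ i j -
      ∑ l : {i // p₁ i}, ∑ k : {i // p₁ i}, M₁ i k * MvPolynomial.C (S₁⁻¹ k l) * M₁ l j with hN'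
  have hN'deg : ∀ i j, (N' i j).totalDegree ≤ 1 := fun i j => by
    rw [hN', Matrix.of_apply]
    exact totalDegree_schur_le M₁ p₁ S₁⁻¹ 1 0 (by norm_num) hdeg (fun i k => hdeg i k)
      (fun l j => le_of_eq (by rw [hZrow l j ((hp₁ _).1 l.2), MvPolynomial.totalDegree_C])) i j
  -- the `P`-columns of `N'` are those of `M₁` (the correction vanishes there)
  have hN'B0 : ∀ (i j : {i // ¬ p₁ i}), P (j : Fin m) → N' i j = M₁ i j := by
    intro i j hj
    rw [hN', Matrix.of_apply, sub_eq_self]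
    refine Finset.sum_eq_zero fun l _ => Finset.sum_eq_zero fun k _ => ?_
    rw [hZB0 l j ((hp₁ _).1 l.2) hj (fun h => j.2 ((hp₁ _).2 h)), mul_zero]
  /- STEP 2: Schur complement through the idle block `P × P` of `N'`. -/
  obtain ⟨p₂, hp₂⟩ : ∃ p₂ : {i // ¬ p₁ i} → Prop, ∀ i, p₂ i ↔ P (i : Fin m) :=
    ⟨_, fun _ => Iff.rfl⟩
  set S₂ : Matrix {i // p₂ i} {i // p₂ i} ℂ := Matrix.of fun i i' => Sf i i' with hS₂
  have hS₂N : ∀ i j : {i : {i // ¬ p₁ i} // p₂ i}, N' i j = MvPolynomial.C (S₂ i j) := by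
    intro i j
    rw [hS₂, Matrix.of_apply, hN'B0 _ _ ((hp₂ _).1 j.2)]
    exact hAB0 _ _ (fun h => i.1.2 ((hp₁ _).2 h)) ((hp₂ _).1 j.2)
  obtain ⟨B0, hB0⟩ : ∃ B0 : Fin m → Prop, ∀ i, B0 i ↔ ¬ U i ∧ P i := ⟨_, fun _ => Iff.rfl⟩
  set SB : Matrix {i // B0 i} {i // B0 i} ℂ := Matrix.of fun i i' => Sf i i' with hSB
  have hSBdet : SB.det = ∏ i : {i // B0 i}, ((s ((i : Fin m), τ₀ i) : ℤ) : ℂ) :=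
    det_idleBlock_eq_prod E a ha hper s τ₀ hτ₀ B0 (fun i hi => hP0 i ((hB0 i).1 hi).2)
      (fun i i' hi hi' hu hv => hPcol i i' ((hB0 i).1 hi).1 ((hB0 i').1 hi').2 hu hv)
      SB (fun i i' => by rw [hSB, Matrix.of_apply, hSf])
  let e₂ : {i : {i // ¬ p₁ i} // p₂ i} ≃ {i // B0 i} :=
    { toFun := fun x => ⟨x.1.1, (hB0 _).2 ⟨fun h => x.1.2 ((hp₁ _).2 h), (hp₂ _).1 x.2⟩⟩
      invFun := fun y => ⟨⟨y.1, fun h => ((hB0 _).1 y.2).1 ((hp₁ _).1 h)⟩,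
        (hp₂ _).2 ((hB0 _).1 y.2).2⟩
      left_inv := fun x => rfl
      right_inv := fun y => rfl }
  have hS₂eq : S₂ = SB.submatrix e₂ e₂ := by
    ext x y; rfl
  have hS₂ne : S₂.det ≠ 0 := by
    rw [hS₂eq, Matrix.det_submatrix_equiv_self, hSBdet]
    exact Finset.prod_ne_zero_iff.2 fun i _ => hunit _
  have hstep2 := det_eq_C_mul_det_schur N' p₂ S₂ hS₂ne hS₂N
  set L : Matrix {i : {i // ¬ p₁ i} // ¬ p₂ i} {i : {i // ¬ p₁ i} // ¬ p₂ i}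
      (MvPolynomial (Fin (n + 3) × Fin (n + 3)) ℂ) :=
    Matrix.of fun (i j : {i : {i // ¬ p₁ i} // ¬ p₂ i}) => N' i j -
      ∑ l : {i // p₂ i}, ∑ k : {i // p₂ i}, N' i k * MvPolynomial.C (S₂⁻¹ k l) * N' l j with hL
  have hLdeg : ∀ i j, (L i j).totalDegree ≤ 1 := fun i j => by
    rw [hL, Matrix.of_apply]
    exact totalDegree_schur_le N' p₂ S₂⁻¹ 0 1 (by norm_num) hN'deg
      (fun i k => le_of_eq (by
        rw [hN'B0 _ _ ((hp₂ _).1 k.2), hAB0 _ _ (fun h => i.1.2 ((hp₁ _).2 h)) ((hp₂ _).1 k.2),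
          MvPolynomial.totalDegree_C]))
      (fun l j => hN'deg l j) i j
  /- `per = C c · det L` with `c ≠ 0` -/
  set c : ℂ := ((Equiv.Perm.sign τ₀ : ℤ) : ℂ) * S₁.det * S₂.det with hc
  have hcne : c ≠ 0 := by
    refine mul_ne_zero (mul_ne_zero ?_ hS₁ne) hS₂ne
    rcases Int.units_eq_one_or (Equiv.Perm.sign τ₀) with h | h <;> simp [h]
  have hsignsq : ((Equiv.Perm.sign τ₀ : ℤ) : MvPolynomial (Fin (n + 3) × Fin (n + 3)) ℂ) *
      ((Equiv.Perm.sign τ₀ : ℤ) : MvPolynomial (Fin (n + 3) × Fin (n + 3)) ℂ) = 1 := by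
    rw [← Int.cast_mul, ← Units.val_mul, Int.units_mul_self, Units.val_one, Int.cast_one]
  have hperL : Literature.Computability.AlgebraicComplexity.perPoly (Fin (n + 3)) ℂ =
      MvPolynomial.C c * L.det := by
    have h1 : M.det = ((Equiv.Perm.sign τ₀ : ℤ) : MvPolynomial (Fin (n + 3) × Fin (n + 3)) ℂ) *
        M₁.det := by
      rw [hdet₁, ← mul_assoc, hsignsq, one_mul]
    rw [← hdetM, h1, hstep1, hstep2, hc, map_mul, map_mul,
      ← map_intCast (MvPolynomial.C : ℂ →+* MvPolynomial (Fin (n + 3) × Fin (n + 3)) ℂ)]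
    ring
  /- reindex `L` to `Fin (n+3)` and scale a row: an affine determinantal representation of size `n+3` -/
  have hcardA : Fintype.card {i : {i // ¬ p₁ i} // ¬ p₂ i} = n + 3 := by
    have e₃ : {i : {i // ¬ p₁ i} // ¬ p₂ i} ≃
        {i : Fin m // ∃ k, a (i, τ₀ i) = MvPolynomial.X k} :=
      { toFun := fun x => ⟨x.1.1, hA _ (fun h => x.1.2 ((hp₁ _).2 h)) (fun h => x.2 ((hp₂ _).2 h))⟩
        invFun := fun y => ⟨⟨y.1, fun h => hU0 _ ((hp₁ _).1 h) y.2⟩,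
          fun h => hP0 _ ((hp₂ _).1 h) y.2⟩
        left_inv := fun x => rfl
        right_inv := fun y => rfl }
    rw [Fintype.card_congr e₃, Fintype.card_subtype, card_var_eq E a ha hper τ₀ hτ₀]
  have e₄ : {i : {i // ¬ p₁ i} // ¬ p₂ i} ≃ Fin (n + 3) := Fintype.equivFinOfCardEq hcardA
  set F₀ : Matrix (Fin (n + 3)) (Fin (n + 3)) (MvPolynomial (Fin (n + 3) × Fin (n + 3)) ℂ) :=
    L.submatrix e₄.symm e₄.symm with hF₀
  have hF₀det : F₀.det = L.det := Matrix.det_submatrix_equiv_self e₄.symm L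
  set F : Matrix (Fin (n + 3)) (Fin (n + 3)) (MvPolynomial (Fin (n + 3) × Fin (n + 3)) ℂ) :=
    F₀.updateRow 0 ((MvPolynomial.C c : MvPolynomial (Fin (n + 3) × Fin (n + 3)) ℂ) • F₀ 0) with hF
  have hFdet : F.det = MvPolynomial.C c * F₀.det := by
    rw [hF, Matrix.det_updateRow_smul, Matrix.updateRow_eq_self]
  have hFdeg : ∀ i j, (F i j).totalDegree ≤ 1 := by
    intro i j
    by_cases hi : i = 0
    · subst hi
      rw [hF, Matrix.updateRow_self, Pi.smul_apply, smul_eq_mul]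
      calc (MvPolynomial.C c * F₀ 0 j).totalDegree
          ≤ (MvPolynomial.C c : MvPolynomial (Fin (n + 3) × Fin (n + 3)) ℂ).totalDegree +
            (F₀ 0 j).totalDegree := MvPolynomial.totalDegree_mul _ _
        _ ≤ 0 + 1 := Nat.add_le_add (le_of_eq (MvPolynomial.totalDegree_C _))
            (by rw [hF₀, Matrix.submatrix_apply]; exact hLdeg _ _)
        _ = 1 := rfl
    · rw [hF, Matrix.updateRow_ne hi, hF₀, Matrix.submatrix_apply]
      exact hLdeg _ _
  have hrepr : HasDetRepr (Literature.Computability.AlgebraicComplexity.perPoly (Fin (n + 3)) ℂ)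
      (n + 3) :=
    ⟨F, fun i j => hFdeg i j, by rw [hFdet, hF₀det, ← hperL]⟩
  have hsq := sq_le_two_mul_of_hasDetRepr_perPoly hrepr
  nlinarith

end Summit.ValiantsHypothesis.ValiantsHypothesis.Theorems.PolyaContinuedMonotoneCoverHard
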